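import Mathlib.GroupTheory.DoubleCoset
import Literature.AnabelianGeometry.AbsoluteAnabelian.AbsCuspSeparated
import Literature.AnabelianGeometry.AbsoluteAnabelian.MLFGaloisTypeProofs
import HarnessLib

/-!
# [AbsCusp] Def. 1.5 (i) / Prop. 2.2 (ii): `SameFibrePoint` IS equality of double cosets;
# the universal closures of the schema rows F-0054 / F-0044 are refuted at toy data

Proof-only companion of `AbsCuspSeparated.lean` (abc-iut-L4 lineage, p408175; imported, never edited).
S. Mochizuki, *Absolute anabelian cuspidalizations of proper hyperbolic curves*, J. Math. Kyoto Univ.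
47 (2007) [AbsCusp], Def. 1.5 (i) p. 31 and Prop. 2.2 (ii) p. 39.  Cell abc-iut, block F (fact-proving
wave), seat abc-iut-f-056, FACT-LIST tranche 56.

* **F-0054 `AbsCusp.SameFibrePoint`** (Def. 1.5 (i) p. 31) is VOCABULARY, not a fact: the relation
  "`g`, `g'` index the same closed point of `X̄_H` over `x`", typed as `∃ h ∈ H, ∃ d ∈ D, g' = h g d`.
  Its docstring sentence "the double cosets `H g D_x`, `H g' D_x` coincide" is PROVED here verbatim
  against Mathlib's double cosets (`sameFibrePoint_iff_doubleCoset_eq`, `sameFibrePoint_iff_mk_eq`: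
  the relation is the kernel of `G → H \ G / D`), together with the equivalence-relation package and
  the two extreme levels (`H = Π`: one fibre point; `H = D = 1`: the relation is equality).  Its
  universal closure is false (`not_forall_sameFibrePoint`, at `Π = ℤ/2ℤ`).
* **F-0044 `AbsCusp.Prop_2_2_ii_model`** (Prop. 2.2 (ii) p. 39: "`X` is `𝔓𝔯𝔦𝔪𝔢𝔰`-separated" for
  proper hyperbolic curves over MLFs) is a NAMED FACT RELATIVE TO an interface `M : CurveModel`
  (typing policy θ, shape (M)).  The interface does not tie `M.decomp` to any geometry, so the
  universal closure over ALL `M` is false: `exists_curveModel_not_isSeparatedCurve` builds, for every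
  prime `p`, WITNESS DATA (not a model of any curve) with one proper scheme-like "curve" over the
  MLF `ℚ_p`, trivial extension `G_{ℚ_p} = G_{ℚ_p}`, no cusps and two "closed points" with the SAME
  decomposition group `Π`; hence `not_forall_prop_2_2_ii_model`.  Consequence of record: the row is
  consumable only AT A NAMED MODEL (as `thm_2_1_i_of_prop_2_2_ii` does, hypothesis `h22`); its
  printed content (Kummer theory of the Jacobian, Prop. 2.2 (i), [Tama] Cor. 2.10 — étale `π₁`) is
  not available from Mathlib and stays a named input.

HONEST FRAMING: statements about OUR typed interface, not about print's Def. 1.5 / Prop. 2.2; refereed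
results typed statements-first (D-0014); typed ≠ proved; no model of any curve is asserted to exist;
nothing here bears on the disputed [IUTchIII] Cor. 3.12; no side taken.
-/

noncomputable section

open scoped Classical Pointwise

namespace Literature.AnabelianGeometry.AbsoluteAnabelian

namespace AbsCusp

open AbsTopIII DoubleCoset

universe u

variable {E : FundamentalExtension.{u}}

/-! ### F-0054: `SameFibrePoint H D` is the double-coset relation `H \ Π / D` -/

/-- `g'` indexes the same point of `X̄_H` over `x` as `g` iff `g'` lies in the double coset `H g D`.
[cite: MochizukiAbsCusp2007, Def 1.5 (i) p.31] -/
theorem sameFibrePoint_iff_mem_doubleCoset (H D : Subgroup E.arith) (g g' : E.arith) :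
    SameFibrePoint H D g g' ↔ g' ∈ doubleCoset g H D :=
  mem_doubleCoset.symm

/-- **The docstring of `SameFibrePoint`, verbatim**: "the double cosets `H g D_x`, `H g' D_x`
coincide". [cite: MochizukiAbsCusp2007, Def 1.5 (i) p.31] -/
theorem sameFibrePoint_iff_doubleCoset_eq (H D : Subgroup E.arith) (g g' : E.arith) :
    SameFibrePoint H D g g' ↔ doubleCoset g H D = doubleCoset g' H D := by
  rw [sameFibrePoint_iff_mem_doubleCoset]
  exact ⟨fun h => (doubleCoset_eq_of_mem h).symm, fun h => h ▸ mem_doubleCoset_self H D g'⟩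

/-- Equivalently: `g`, `g'` have the same image in `H \ Π / D` (the closed points of `X̄_H` over `x`
"are indexed by the double cosets `H \ Π_X / D_x`"). [cite: MochizukiAbsCusp2007, Def 1.5 (i) p.31] -/
theorem sameFibrePoint_iff_mk_eq (H D : Subgroup E.arith) (g g' : E.arith) :
    SameFibrePoint H D g g' ↔ DoubleCoset.mk H D g = DoubleCoset.mk H D g' :=
  (DoubleCoset.eq H D g g').symm

/-- `SameFibrePoint H D` is reflexive. [cite: MochizukiAbsCusp2007, Def 1.5 (i) p.31] -/
theorem SameFibrePoint.refl (H D : Subgroup E.arith) (g : E.arith) : SameFibrePoint H D g g :=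
  ⟨1, H.one_mem, 1, D.one_mem, by rw [one_mul, mul_one]⟩

/-- `SameFibrePoint H D` is symmetric. [cite: MochizukiAbsCusp2007, Def 1.5 (i) p.31] -/
theorem SameFibrePoint.symm {H D : Subgroup E.arith} {g g' : E.arith} (h : SameFibrePoint H D g g') :
    SameFibrePoint H D g' g := by
  obtain ⟨a, ha, d, hd, rfl⟩ := h
  exact ⟨a⁻¹, H.inv_mem ha, d⁻¹, D.inv_mem hd, by group⟩

/-- `SameFibrePoint H D` is transitive. [cite: MochizukiAbsCusp2007, Def 1.5 (i) p.31] -/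
theorem SameFibrePoint.trans {H D : Subgroup E.arith} {g g' g'' : E.arith}
    (h : SameFibrePoint H D g g') (h' : SameFibrePoint H D g' g'') : SameFibrePoint H D g g'' := by
  obtain ⟨a, ha, d, hd, rfl⟩ := h
  obtain ⟨a', ha', d', hd', rfl⟩ := h'
  exact ⟨a' * a, H.mul_mem ha' ha, d * d', D.mul_mem hd hd', by group⟩

/-- `SameFibrePoint H D g g'` is symmetric in `g`, `g'`. [cite: MochizukiAbsCusp2007, Def 1.5 (i) p.31] -/
theorem sameFibrePoint_comm {H D : Subgroup E.arith} {g g' : E.arith} :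
    SameFibrePoint H D g g' ↔ SameFibrePoint H D g' g :=
  ⟨SameFibrePoint.symm, SameFibrePoint.symm⟩

/-- `SameFibrePoint H D` is an equivalence relation on `Π` (its classes = the closed points of `X̄_H`
over `x`). [cite: MochizukiAbsCusp2007, Def 1.5 (i) p.31] -/
theorem sameFibrePoint_equivalence (H D : Subgroup E.arith) : Equivalence (SameFibrePoint H D) :=
  ⟨SameFibrePoint.refl H D, SameFibrePoint.symm, SameFibrePoint.trans⟩

/-- Level `H = Π` (the trivial covering `X → X`): there is ONE point over `x`, every `g`, `g'` index it.
[cite: MochizukiAbsCusp2007, Def 1.5 (i) p.31] -/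
theorem sameFibrePoint_top (D : Subgroup E.arith) (g g' : E.arith) : SameFibrePoint ⊤ D g g' :=
  ⟨g' * g⁻¹, Subgroup.mem_top _, 1, D.one_mem, by group⟩

/-- With `H = D = 1` the relation is EQUALITY of the indexing elements.
[cite: MochizukiAbsCusp2007, Def 1.5 (i) p.31] -/
theorem sameFibrePoint_bot_bot_iff (g g' : E.arith) :
    SameFibrePoint (⊥ : Subgroup E.arith) ⊥ g g' ↔ g = g' := by
  constructor
  · rintro ⟨a, ha, d, hd, rfl⟩
    rw [Subgroup.mem_bot] at ha hd
    rw [ha, hd, one_mul, mul_one]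
  · rintro rfl
    exact SameFibrePoint.refl ⊥ ⊥ g

/-- **FACT-LIST F-0054, universal closure REFUTED** (universe `0`): `SameFibrePoint` is a RELATION
(Def. 1.5 (i) bookkeeping), not a fact — in the extension `ℤ/2ℤ = ℤ/2ℤ` (identity augmentation) the
two elements of `Π` index DIFFERENT points at level `H = D = 1`.  A statement about the typed
vocabulary only. [cite: MochizukiAbsCusp2007, Def 1.5 (i) p.31] -/
theorem not_forall_sameFibrePoint :
    ¬ ∀ (E : FundamentalExtension.{0}) (H D : Subgroup E.arith) (g g' : E.arith),
      SameFibrePoint H D g g' := by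
  intro h
  let P : ProfiniteGrp.{0} := ProfiniteGrp.ofFiniteGrp (FiniteGrp.of (Multiplicative (ZMod 2)))
  have hP : Nontrivial (Multiplicative (ZMod 2)) :=
    ⟨⟨Multiplicative.ofAdd 0, Multiplicative.ofAdd 1,
      Multiplicative.ofAdd.injective.ne (by decide : (0 : ZMod 2) ≠ 1)⟩⟩
  haveI : Nontrivial P := hP
  let E : FundamentalExtension.{0} := ⟨P, P, ContinuousMonoidHom.id _, Function.surjective_id⟩
  obtain ⟨x, y, hxy⟩ := exists_pair_ne E.arith
  exact hxy ((sameFibrePoint_bot_bot_iff (E := E) x y).1 (h E ⊥ ⊥ x y))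

/-! ### F-0044: the universal closure of `Prop_2_2_ii_model` over ALL interfaces `M` is false -/

/-- **WITNESS DATA for F-0044** (not a model of any curve): for every prime `p` there is an interface
`M : CurveModel` with a "curve" `X` flagged proper and scheme-like over the MLF `ℚ_p` (extension
`G_{ℚ_p} = G_{ℚ_p}`, no cusps) carrying TWO "closed points" with the same decomposition group `Π`, so
that `X` is not `𝔓𝔯𝔦𝔪𝔢𝔰`-separated in the sense of Def. 1.5 (i) (`IsSeparatedCurve`).  The interface
`CurveModel` records `decomp` as bare data; print's Prop. 2.2 (ii) concerns the étale `π₁`, which the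
tree does not construct. [cite: MochizukiAbsCusp2007, Prop 2.2 (ii) p.39] -/
theorem exists_curveModel_not_isSeparatedCurve (p : ℕ) [Fact p.Prime] :
    ∃ (M : CurveModel.{0}) (X : M.Curve),
      M.IsProper X ∧ M.IsScheme X ∧ IsMLF (M.base X) ∧ ¬ IsSeparatedCurve M X := by
  let E₀ : FundamentalExtension.{0} :=
    ⟨absoluteGaloisGrp ℚ_[p], absoluteGaloisGrp ℚ_[p], ContinuousMonoidHom.id _,
      Function.surjective_id⟩
  let C₀ : E₀.CuspidalData :=
    { Cusp := PEmpty
      Dcusp := fun c => c.elim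
      Icusp := fun c => c.elim
      Icusp_eq := fun c => c.elim
      isClosed_Dcusp := fun c => c.elim
      eq_of_conj := fun c => c.elim }
  let M : CurveModel.{0} :=
    { Curve := PUnit
      base := fun _ => ℚ_[p]
      ext := fun _ => E₀
      galIso := fun _ => CategoryTheory.Iso.refl _
      cusps := fun _ => C₀
      IsProper := fun _ => True
      IsScheme := fun _ => True
      genus := fun _ => 2
      FunctionField := fun _ => ℚ_[p]
      Point := fun _ => Bool
      decomp := fun _ _ => ⊤
      IsNFCurve := fun _ => False
      IsNFPoint := fun _ _ => False
      IsNFRational := fun _ _ => False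
      IsNFConstant := fun _ _ => False
      NFFunctionField := fun _ => ℚ_[p]
      IsStrictlyBelyiType := fun _ => False
      IsCofiniteOpen := fun _ _ => True
      res := fun _ => CategoryTheory.CategoryStruct.id _ }
  refine ⟨M, PUnit.unit, trivial, trivial, isMLF_padic p, fun hX => ?_⟩
  have h := hX.point_eq_of_conj (x := true) (y := false) (g := 1) (by simp [M])
  exact Bool.noConfusion h

/-- **FACT-LIST F-0044, universal closure REFUTED** (universe `0`): `Prop_2_2_ii_model M` fails for
the witness interface of `exists_curveModel_not_isSeparatedCurve` (any prime, here `p = 2`).  So the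
row [AbsCusp] Prop. 2.2 (ii) is consumable only AT A NAMED MODEL `M` (as in
`thm_2_1_i_of_prop_2_2_ii`, hypothesis `h22`), never as its closure over all interfaces; this refutes
OUR `∀ M`-reading of a shape-(M) schema, not print's Proposition 2.2 (ii).
[cite: MochizukiAbsCusp2007, Prop 2.2 (ii) p.39] -/
theorem not_forall_prop_2_2_ii_model : ¬ ∀ M : CurveModel.{0}, Prop_2_2_ii_model M := by
  intro h
  haveI : Fact (Nat.Prime 2) := ⟨Nat.prime_two⟩
  obtain ⟨M, X, hP, hS, hk, hsep⟩ := exists_curveModel_not_isSeparatedCurve 2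
  exact hsep (h M X hP hS hk)

end AbsCusp

end Literature.AnabelianGeometry.AbsoluteAnabelian
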